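import Summits.QuantumFields.YangMills.Theorems.BalabanUVNodesN18KingModelAllLines

/-!
# BalabanUVNodes ∕ N18 — LINE READ-OUTS FOR THE POLYMER REPRESENTATION OF KING'S MODEL: every line of the torus carried
# exactly once by a selection of connecting polymers; CONFIGURATION-DEPENDENT located read-outs are `NE5` on the END's
# carriers `torusCarriers` ∕ `reFunctional`; King's (3.73) first bound PER LINE in block distance (Track A, DAG node N18 =
# NE5 `T4OutputRate.NE5 EA EB W κ θ C₅` :211; director-ym R134 row n18 s3 «King-model transfer `N18KingModelTorus` (κ, C₅
# from (d, L, a, m², γ)) → `TwoRunTorusNE5Final*`», module 4a of seat pub-ymgap-dag-n18-e; module 4b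
# `BalabanUVNodesN18KingModelPolymerRep` composes these into the polymer representation (0.24) of the model)

HONEST FRAMING.  Count-neutral kernel bookkeeping (seat pub-ymgap-dag-n18-e g4, strategy s3; `--supports` K3′
`SpineGivenEndpointR12`, helper).  Generic torus combinatorics ∕ real analysis around the cell's `NE5` shape, and King's
`A = 0` scalar MODEL ([King1986], printed and proved, typed by seats n18-a∕n18-b) — NOT Bałaban's covariant one-step outputs
`E^{(j)}(X; g, U_k(V))` of [Balaban1987RG1] (0.24)∕(2.13), for which NE5 is NOT IN PRINT and has no tree producer (NODE O
instance 0∕1); NOT a node discharge; finite tori; nothing continuum ∕ ℝ⁴ ∕ OS ∕ mass-gap ∕ Clay.  THEOREMS ONLY: 0 `def`,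
0 `sorry`, standard axioms.

THE POINT.  Modules 1–3 of this seat (`N18KingModelEndDecay` p458808, `N18EndCarriersLineSums` p459720,
`N18KingModelAllLines` p465902) prove `NE5` on the END's carriers for read-outs `K_A, K_B` that are BINDERS with the
hypothesis `K_A X − K_B X = Σ_{lines of X} (G_A − G_B)`, read FIELD-BLIND (`reFunctional N W fun j X _ => K⟨j, X⟩`), and
module 3 §3 supplies a selection reading without defining a read-out.  The three ingredients that turn this into the
polymer representation (0.24) `E^{(j)} = Σ_{X ∈ 𝐃_j} E^{(j)}(X)` of the model (module 4b) are:
* §1 (d, N general) **`sum_tdom_selection`** — EVERY LINE EXACTLY ONCE: for a selection `Xsel (p, q) ∈ 𝐃_j ∋ p, q`,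
  `Σ_{X : 𝐃_j} Σ_{(p,q) ∈ X×X} [Xsel (p,q) = X]·g(p,q) = Σ_{(p,q)} g(p,q)` (the torus catalogue is a finite type,
  `TreeLengthTorus.instFintypeTDom`; `Finset.sum_comm`, `Finset.sum_ite_eq`); `selection_reading_local`: the reading of `X`
  is a sum over a set of lines OF `X`.
* §2 (the END's carriers) CONFIGURATION-DEPENDENT read-outs `K : (X : Σ j, 𝐃_j) → (W X.1).Φ → ℝ`, read as genuine
  functionals `reFunctional N W fun j X φ => K⟨j, X⟩ φ` of the scale-`j` configuration (transport = identity: both runs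
  read the SAME `φ` — NE5's «at fixed arguments»): **`ne5_reFunctional_of_fieldLocated`** (located uniformly in `φ` ⇒
  `NE5`; the `φ`-dependent twin of p450669 `ne5_reFunctional_of_real`) and **`ne5_reFunctional_of_fieldCubePairs`** (the
  `φ`-dependent twin of p459720 §5: differences that are sums over all pairs of cubes of located line contributions are
  `NE5 … (κ∕2) θ (C₅·(4·2^4)²·2!(2∕κ)²e^{κ∕2})`).
* §3 (d general) **`abs_kingGraph_sub_le_of_readings`** — King's (3.73) first bound PER LINE, in block distance, for
  King's ACTUAL (4.42) three-factor graphs: `∃ κ > 0, C₅ ≥ 0` ((d, L, a, m², γ) only: the letters of p418046) with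
  `|G_A(l) − G_B(l)| ≤ C₅·(L^{−γ∕2})^{s_l}·e^{−κ|B(x_A l) − B(y_A l)|_{T₁}}` for ANY index type of lines `l` with King scale
  `s_l ≥ 1` and readings `x_A l, y_A l` under `x_B l, y_B l` (p418046 `ne5_kingModel_threeFactor_torus` on line-indexed
  carriers whose tree length IS the block distance — the per-line form modules 1–3 each re-derived inside a proof).
WHAT THIS DOES NOT DO.  Lines are pairs of BLOCKS (fine-point multiplicity and King's (2.20)-rescaling `(L^jη)^{2−d−γ}`
stay outside, as in the whole n18-a∕-e lineage); `A = 0`, `g`∕`U` unread; NOT Bałaban's `E^{(j)}(X; g, U)`.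

Sources: C. King, Commun. Math. Phys. **102** (1986) 649–677 [King1986] — Prop. 3.9 (3.73) p. 665, (4.42)–(4.43) p. 675,
p. 664 («x′ ∈ B^n(x)»); T. Bałaban, Commun. Math. Phys. **109** (1987) 249–301 [Balaban1987RG1] — (0.24)–(0.25) p. 257
(localization expansions over `𝐃_j`, `d_j(X)`), Thm 1 p. 259; **116** (1988) 1–22 [Balaban1988RG2Cluster] (2.30) p. 18;
**102** (1985) 255–275 [Balaban1985UV3] p. 262 (*"The localizations {□_j} and the walks ω replacing lines of the graph
define a localization X"*).  No claim about the mass gap.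
-/

noncomputable section

namespace Summit.QuantumFields.YangMills.BalabanUVNodes.N18KingModelLineReadouts

open Matrix
open Literature.MathematicalPhysics.QuantumFieldTheory.Balaban1983to89
open Literature.MathematicalPhysics.QuantumFieldTheory.Balaban1983to89.T4OutputRate (Carriers Functional NE5)
open Literature.MathematicalPhysics.QuantumFieldTheory.Balaban1983to89.B5Prop11Plancherel (Tor fine)
open Literature.MathematicalPhysics.QuantumFieldTheory.Balaban1983to89.TreeLengthTorus
  (TPt TDom torusTreeLen torusTreeLen_nonneg tsys)
open Literature.MathematicalPhysics.QuantumFieldTheory.Balaban1983to89.B13Lemma3Torus (TwoTorusStep)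
open Literature.MathematicalPhysics.QuantumFieldTheory.King1986 (aK)
open Literature.MathematicalPhysics.QuantumFieldTheory.King1986.Torus
  (minimiser effLaplacian blockProj blockOf tdistT tdistT_nonneg)
open Summit.QuantumFields.BalabanUV.T4Continuum.Spine.NE5.TwoRunTorusNE5 (torusCarriers reFunctional)
open Summit.QuantumFields.YangMills.BalabanUVNodes.N18KingModelTorus (ne5_kingModel_threeFactor_torus)
open Summit.QuantumFields.YangMills.BalabanUVNodes.N18EndCarriersLineSums
  (polyTreeLoss_le polyTreeLoss_const_pos card_pairs_le_of_tdom)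

/-! ## §1 Every line exactly once: resummation of a selection reading over the torus catalogue (d, N general) -/

section Resummation
variable {d N : ℕ} [NeZero N]

open Classical in
/-- **EVERY LINE EXACTLY ONCE.**  Let every ordered pair of cubes `(p, q)` of the torus `(ℤ∕N)^d` SELECT a localization
domain `Xsel (p, q) ∈ 𝐃_j` containing both cubes.  Reading at each domain `X` the lines `(p, q) ∈ X × X` whose selected
domain is `X`, the sum over the (finite) torus catalogue `𝐃_j` of the domain readings is the sum over ALL lines:
`Σ_{X : 𝐃_j} Σ_{(p,q) ∈ X×X} [Xsel (p,q) = X]·g (p,q) = Σ_{(p,q)} g (p,q)` — no line lost, none counted twice; (0.24)'s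
`E^{(j)} = Σ_{X ∈ 𝐃_j} E^{(j)}(X)` for a two-point graph distributed over connecting polymers.
[cite: Balaban1987RG1, (0.24) p.257; Balaban1985UV3, p.262] -/
theorem sum_tdom_selection (Xsel : TPt d N × TPt d N → TDom d N) (hmem : ∀ pq, pq ∈ (Xsel pq).1 ×ˢ (Xsel pq).1)
    (g : TPt d N × TPt d N → ℝ) :
    ∑ X : TDom d N, ∑ pq ∈ X.1 ×ˢ X.1, (if Xsel pq = X then g pq else 0) = ∑ pq, g pq := by
  calc ∑ X : TDom d N, ∑ pq ∈ X.1 ×ˢ X.1, (if Xsel pq = X then g pq else 0)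
      = ∑ X : TDom d N, ∑ pq, (if Xsel pq = X then g pq else 0) := by
        refine Finset.sum_congr rfl fun X _ => Finset.sum_subset (Finset.subset_univ _) fun pq _ hpq => ?_
        rw [if_neg]
        rintro rfl
        exact hpq (hmem pq)
    _ = ∑ pq, ∑ X : TDom d N, (if Xsel pq = X then g pq else 0) := Finset.sum_comm
    _ = ∑ pq, g pq := Finset.sum_congr rfl fun pq _ => by
        rw [Finset.sum_ite_eq, if_pos (Finset.mem_univ _)]

open Classical in
/-- **LOCALITY OF THE SELECTION READING.**  The reading of `X` is a sum over a set of LINES OF `X` (pairs of cubes of `X`):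
`Σ_{(p,q) ∈ X×X} [Xsel (p,q) = X]·g (p,q) = Σ_{(p,q) ∈ S} g (p,q)` with `S = {(p,q) ∈ X×X : Xsel (p,q) = X} ⊆ X × X`.
[cite: Balaban1987RG1, (0.24) p.257] -/
theorem selection_reading_local (Xsel : TPt d N × TPt d N → TDom d N) (X : TDom d N) (g : TPt d N × TPt d N → ℝ) :
    ∑ pq ∈ X.1 ×ˢ X.1, (if Xsel pq = X then g pq else 0)
      = ∑ pq ∈ (X.1 ×ˢ X.1).filter (fun pq => Xsel pq = X), g pq := by
  rw [Finset.sum_filter]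

end Resummation

/-! ## §2 Configuration-dependent read-outs on the END's carriers -/

section FieldReadouts
variable {L' : ℕ} [NeZero L']

/-- **CONFIGURATION-DEPENDENT LOCATED READ-OUTS ARE `NE5` ON THE END'S CARRIERS.**  Real families `K_A, K_B` on `Σ_j 𝐃_j`
DEPENDING ON THE SCALE-`j` CONFIGURATION `φ : (W j).Φ`, located uniformly in `φ` —
`|K_A⟨j,X⟩ φ − K_B⟨j,X⟩ φ| ≤ C₅·θ^j·e^{−κ′·d_j(X)}` (`C₅, θ ≥ 0`) — read through `TwoRunTorusNE5.reFunctional` as the genuine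
functionals `E_A j X φ = K_A⟨j,X⟩ φ`, `E_B j X φ = K_B⟨j,X⟩ φ` (real part on the space `(W j).sp2 X`, `0` off it) satisfy
`NE5 (torusCarriers N W) (reFunctional N W E_A) (reFunctional N W E_B) W′ κ′ θ C₅` for every window `W′` — the carriers,
read-out and conclusion of `TwoRunTorusNE5Final8.ne5_end_final_all8` (transport = identity: both runs read the SAME `φ`,
NE5's «at fixed arguments»).  The `φ`-dependent twin of `N18KingModelU3Rung.ne5_reFunctional_of_real`.
[cite: Balaban1987RG1, (0.24)-(0.25) p.257, Thm 1 p.259] -/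
theorem ne5_reFunctional_of_fieldLocated (N : ℕ → ℕ) [∀ j, NeZero (N j)] (W : (j : ℕ) → TwoTorusStep 4 L' (N j))
    (KA KB : (X : Σ j : ℕ, TDom 4 (N j)) → (W X.1).Φ → ℝ) {κ' θ C₅ : ℝ} (hC₅ : 0 ≤ C₅) (hθ : 0 ≤ θ)
    (hK : ∀ (X : Σ j : ℕ, TDom 4 (N j)) (φ : (W X.1).Φ),
      |KA X φ - KB X φ| ≤ C₅ * θ ^ X.1 * Real.exp (-(κ' * torusTreeLen X.2.1)))
    (W' : Set (ℕ → ℝ)) :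
    NE5 (C := torusCarriers N W) (reFunctional N W fun j X φ => ((KA ⟨j, X⟩ φ : ℝ) : ℂ))
      (reFunctional N W fun j X φ => ((KB ⟨j, X⟩ φ : ℝ) : ℂ)) W' κ' θ C₅ := by
  intro g _ U X
  obtain ⟨j, X⟩ := X
  show |reFunctional N W (fun j X φ => ((KA ⟨j, X⟩ φ : ℝ) : ℂ)) g (id U) ⟨j, X⟩
      - reFunctional N W (fun j X φ => ((KB ⟨j, X⟩ φ : ℝ) : ℂ)) g U ⟨j, X⟩|
    ≤ C₅ * θ ^ j * Real.exp (-(κ' * (tsys 4 (N j)).dj X))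
  by_cases hφ : U j ∈ (W j).sp2 X
  · simp only [reFunctional, id, hφ, if_true, Complex.ofReal_re]
    exact hK ⟨j, X⟩ (U j)
  · simp only [reFunctional, id, hφ, if_false, sub_zero, abs_zero]
    positivity

/-- **THE «ALL PAIRS OF CUBES» READING, CONFIGURATION-DEPENDENT, IS `NE5` AT THE END'S CARRIERS.**  If two
configuration-dependent read-outs differ at each domain `⟨j, X⟩` and configuration `φ` by the sum over ALL pairs `(p, q)`
of cubes of `X` of line contributions located at `X` uniformly in `φ` — `|G_A X φ (p,q) − G_B X φ (p,q)| ≤ C₅·θ^j·e^{−κ·d_j(X)}`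
(`κ > 0`, `θ, C₅ ≥ 0`; pairs not so located are to be given `G_A = G_B`) — then
`NE5 (torusCarriers N W) (reFunctional … K_A) (reFunctional … K_B) W′ (κ∕2) θ (C₅·(4·2^4)²·(2!(2∕κ)²e^{κ∕2}))`: the
`(4·2^4)²(d_j(X) + 1)²` lines of a domain (`N18EndCarriersLineSums.card_pairs_le_of_tdom`, (2.30) lower half) cost half the
exponent (`polyTreeLoss_le`).  The `φ`-dependent twin of `N18EndCarriersLineSums.ne5_reFunctional_of_cubePairs`.
[cite: Balaban1987RG1, (0.24)-(0.25) p.257, Thm 1 p.259; Balaban1988RG2Cluster, (2.30) p.18] -/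
theorem ne5_reFunctional_of_fieldCubePairs (N : ℕ → ℕ) [∀ j, NeZero (N j)]
    (W : (j : ℕ) → TwoTorusStep 4 L' (N j)) (KA KB : (X : Σ j : ℕ, TDom 4 (N j)) → (W X.1).Φ → ℝ)
    (GA GB : (X : Σ j : ℕ, TDom 4 (N j)) → (W X.1).Φ → TPt 4 (N X.1) × TPt 4 (N X.1) → ℝ)
    {κ θ C₅ : ℝ} (hκ : 0 < κ) (hθ : 0 ≤ θ) (hC₅ : 0 ≤ C₅)
    (hK : ∀ X φ, KA X φ - KB X φ = ∑ pq ∈ X.2.1 ×ˢ X.2.1, (GA X φ pq - GB X φ pq))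
    (hG : ∀ X φ, ∀ pq ∈ X.2.1 ×ˢ X.2.1,
      |GA X φ pq - GB X φ pq| ≤ C₅ * θ ^ X.1 * Real.exp (-(κ * torusTreeLen X.2.1)))
    (W' : Set (ℕ → ℝ)) :
    NE5 (C := torusCarriers N W) (reFunctional N W fun j X φ => ((KA ⟨j, X⟩ φ : ℝ) : ℂ))
      (reFunctional N W fun j X φ => ((KB ⟨j, X⟩ φ : ℝ) : ℂ)) W' (κ / 2) θ
      (C₅ * (4 * 2 ^ 4) ^ 2 * (((2 : ℕ).factorial : ℝ) * (2 / κ) ^ 2 * Real.exp (κ / 2))) := by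
  have hBpos := polyTreeLoss_const_pos hκ 2
  refine ne5_reFunctional_of_fieldLocated N W KA KB (by positivity) hθ (fun X φ => ?_) W'
  have hθX : 0 ≤ θ ^ X.1 := pow_nonneg hθ _
  have ht : 0 ≤ torusTreeLen X.2.1 := torusTreeLen_nonneg _
  have hB := polyTreeLoss_le hκ 2 ht
  have hP : (((X.2.1 ×ˢ X.2.1).card : ℕ) : ℝ) ≤ (4 * 2 ^ 4) ^ 2 * (torusTreeLen X.2.1 + 1) ^ 2 :=
    card_pairs_le_of_tdom X.2
  calc |KA X φ - KB X φ| = |∑ pq ∈ X.2.1 ×ˢ X.2.1, (GA X φ pq - GB X φ pq)| := by rw [hK X φ]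
    _ ≤ ∑ pq ∈ X.2.1 ×ˢ X.2.1, |GA X φ pq - GB X φ pq| := Finset.abs_sum_le_sum_abs _ _
    _ ≤ ∑ _pq ∈ X.2.1 ×ˢ X.2.1, C₅ * θ ^ X.1 * Real.exp (-(κ * torusTreeLen X.2.1)) :=
        Finset.sum_le_sum (hG X φ)
    _ = (X.2.1 ×ˢ X.2.1).card * (C₅ * θ ^ X.1 * Real.exp (-(κ * torusTreeLen X.2.1))) := by
        rw [Finset.sum_const, nsmul_eq_mul]
    _ ≤ (4 * 2 ^ 4) ^ 2 * (torusTreeLen X.2.1 + 1) ^ 2 * (C₅ * θ ^ X.1 * Real.exp (-(κ * torusTreeLen X.2.1))) :=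
        mul_le_mul_of_nonneg_right hP (by positivity)
    _ = (4 * 2 ^ 4) ^ 2 * C₅ * θ ^ X.1
          * ((torusTreeLen X.2.1 + 1) ^ 2 * Real.exp (-(κ * torusTreeLen X.2.1))) := by ring
    _ ≤ (4 * 2 ^ 4) ^ 2 * C₅ * θ ^ X.1 * ((((2 : ℕ).factorial : ℝ) * (2 / κ) ^ 2 * Real.exp (κ / 2))
          * Real.exp (-(κ / 2 * torusTreeLen X.2.1))) :=
        mul_le_mul_of_nonneg_left hB (by positivity)
    _ = C₅ * (4 * 2 ^ 4) ^ 2 * (((2 : ℕ).factorial : ℝ) * (2 / κ) ^ 2 * Real.exp (κ / 2)) * θ ^ X.1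
          * Real.exp (-(κ / 2 * torusTreeLen X.2.1)) := by ring

end FieldReadouts

/-! ## §3 King's (3.73) first bound PER LINE, in block distance (d general) -/

section PerLine
variable {d : ℕ}

/-- **KING'S TWO-RUN RATE FOR THE (4.42) THREE-FACTOR GRAPHS, LINE BY LINE, IN BLOCK DISTANCE.**  For `d ≥ 1`, odd `L > 1`,
`a > 0`, `m² > 0`, `0 ≤ γ ≤ 1` there are `κ > 0`, `C₅ ≥ 0` — functions of `d, L, a, m², γ` ONLY (the letters of
`N18KingModelTorus.ne5_kingModel_threeFactor_torus`) — such that for every `n ≥ 1`, every family of unit tori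
`L·M_k(μ) = 2L^{m_k}`, every index type of LINES `l` with King scale `s_l ≥ 1` and readings of run-A fine points
`x_A l, y_A l ∈ T_η` (`L^{s_l}` points per unit side) UNDER run B's `x_B l, y_B l` (`L^nL^{s_l}` points), and every line `l`:
`|Σ_{z,w} ℋ_{s}(x_A l, z)·C^{(s)}(z, w)·ℋ_{s}(y_A l, w) − Σ_{z,w} ℋ_{s+n}(x_B l, z)·C^{(s+n)}(z, w)·ℋ_{s+n}(y_B l, w)|`
`≤ C₅·(L^{−γ∕2})^{s_l}·e^{−κ·|B(x_A l) − B(y_A l)|_{T₁}}` (`ℋ = minimiser`, `C^{(·)} = (effLaplacian + aL⁻²·blockProj)⁻¹`, King's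
ACTUAL `A = 0` operators).  p418046 on the carriers `{Dom := lines, scale := s, d := block distance of the line's run-A
readings, backgrounds := PUnit, transport := id}`, window `univ`, coupling `1`. [cite: King1986, Prop. 3.9 (3.73) p.665, (4.42)–(4.43) p.675, p.664] -/
theorem abs_kingGraph_sub_le_of_readings (hd : 1 ≤ d) (L : ℕ) [NeZero L] (hLp : Odd L ∧ 1 < L) {a m2 : ℝ}
    (ha : 0 < a) (hm : 0 < m2) {γ : ℝ} (hγ0 : 0 ≤ γ) (hγ1 : γ ≤ 1) :
    ∃ κ C₅ : ℝ, 0 < κ ∧ 0 ≤ C₅ ∧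
      ∀ (n : ℕ) (_hn : 1 ≤ n) (M : ℕ → Fin d → ℕ) [∀ k μ, NeZero (M k μ)]
        (_hM : ∀ k, ∃ mm : ℕ, ∀ μ, L * M k μ = 2 * L ^ mm)
        (ι : Type) (s : ι → ℕ) (_hs : ∀ l, 1 ≤ s l)
        (xA yA : (l : ι) → Tor (fine (L ^ s l) (fine L (M (s l)))))
        (xB yB : (l : ι) → Tor (fine (L ^ n * L ^ s l) (fine L (M (s l)))))
        (_hx : ∀ l μ, (xA l μ).val = (xB l μ).val / L ^ n)
        (_hy : ∀ l μ, (yA l μ).val = (yB l μ).val / L ^ n) (l : ι),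
        |(fun z => minimiser (L ^ s l) (fine L (M (s l))) (aK a L (s l)) (((L ^ s l : ℕ) : ℝ) ^ 2) m2
              (Pi.single z 1) (xA l))
            ⬝ᵥ ((effLaplacian (L ^ s l) (fine L (M (s l))) (aK a L (s l)) (((L ^ s l : ℕ) : ℝ) ^ 2) m2
                  + (a * ((L : ℝ) ^ 2)⁻¹) • blockProj L (M (s l)))⁻¹
                *ᵥ fun w => minimiser (L ^ s l) (fine L (M (s l))) (aK a L (s l)) (((L ^ s l : ℕ) : ℝ) ^ 2) m2
                    (Pi.single w 1) (yA l))
          - (fun z => minimiser (L ^ n * L ^ s l) (fine L (M (s l))) (aK a L (s l + n))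
              (((L ^ n * L ^ s l : ℕ) : ℝ) ^ 2) m2 (Pi.single z 1) (xB l))
            ⬝ᵥ ((effLaplacian (L ^ n * L ^ s l) (fine L (M (s l))) (aK a L (s l + n))
                    (((L ^ n * L ^ s l : ℕ) : ℝ) ^ 2) m2
                  + (a * ((L : ℝ) ^ 2)⁻¹) • blockProj L (M (s l)))⁻¹
                *ᵥ fun w => minimiser (L ^ n * L ^ s l) (fine L (M (s l))) (aK a L (s l + n))
                    (((L ^ n * L ^ s l : ℕ) : ℝ) ^ 2) m2 (Pi.single w 1) (yB l))|
          ≤ C₅ * ((L : ℝ) ^ (-(γ / 2))) ^ s l * Real.exp (-(κ * tdistT (fine L (M (s l)))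
              (blockOf (L ^ s l) (fine L (M (s l))) (xA l)) (blockOf (L ^ s l) (fine L (M (s l))) (yA l)))) := by
  obtain ⟨κ, C₅, hκ, hC₅, H⟩ := ne5_kingModel_threeFactor_torus hd L hLp ha hm hγ0 hγ1
  refine ⟨κ, C₅, hκ, hC₅, ?_⟩
  intro n hn M _ hM ι s hs xA yA xB yB hx hy l
  -- the LINE-indexed carriers: King's scale `s l`, tree length = the block distance of the line's run-A readings
  let C' : Carriers :=
    { Dom := ι, scale := s,
      d := fun l => tdistT (fine L (M (s l))) (blockOf (L ^ s l) (fine L (M (s l))) (xA l))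
        (blockOf (L ^ s l) (fine L (M (s l))) (yA l)),
      d_nonneg := fun l => tdistT_nonneg _ _ _,
      BgA := PUnit, BgB := PUnit, gauge := fun _ _ => 0, gauge_nonneg := fun _ _ => le_rfl, transport := id }
  have h5 := H n hn M hM C' hs xA yA xB yB hx hy (fun _ => le_rfl)
    (fun _ _ l => (fun z => minimiser (L ^ s l) (fine L (M (s l))) (aK a L (s l)) (((L ^ s l : ℕ) : ℝ) ^ 2) m2
        (Pi.single z 1) (xA l))
      ⬝ᵥ ((effLaplacian (L ^ s l) (fine L (M (s l))) (aK a L (s l)) (((L ^ s l : ℕ) : ℝ) ^ 2) m2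
            + (a * ((L : ℝ) ^ 2)⁻¹) • blockProj L (M (s l)))⁻¹
          *ᵥ fun w => minimiser (L ^ s l) (fine L (M (s l))) (aK a L (s l)) (((L ^ s l : ℕ) : ℝ) ^ 2) m2
              (Pi.single w 1) (yA l)))
    (fun _ _ l => (fun z => minimiser (L ^ n * L ^ s l) (fine L (M (s l))) (aK a L (s l + n))
        (((L ^ n * L ^ s l : ℕ) : ℝ) ^ 2) m2 (Pi.single z 1) (xB l))
      ⬝ᵥ ((effLaplacian (L ^ n * L ^ s l) (fine L (M (s l))) (aK a L (s l + n))
              (((L ^ n * L ^ s l : ℕ) : ℝ) ^ 2) m2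
            + (a * ((L : ℝ) ^ 2)⁻¹) • blockProj L (M (s l)))⁻¹
          *ᵥ fun w => minimiser (L ^ n * L ^ s l) (fine L (M (s l))) (aK a L (s l + n))
              (((L ^ n * L ^ s l : ℕ) : ℝ) ^ 2) m2 (Pi.single w 1) (yB l)))
    (fun _ _ _ => rfl) (fun _ _ _ => rfl) Set.univ
  exact h5 (fun _ => 1) (Set.mem_univ _) PUnit.unit l

end PerLine

end Summit.QuantumFields.YangMills.BalabanUVNodes.N18KingModelLineReadouts

end
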